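import Mathlib
import Summits.AnomalousDissipation.AnomalousDissipation.Theorems.MarginalStabilityChainStretchedVortexRowsStubRowVorticityConstructionTools

/-!
# Stub `stub_rowVorticityConstruction` (crux stmt-AnomalousDissipation-3009) — tools III:
# the period strip and the Gaussian-testability of the cylinder kernels

Helper file (supports stmt-AnomalousDissipation-3009). The cylinder Biot–Savart law integrates over ONE
period: the centred strip `S_L = (−L/2, L/2] × ℝ ⊆ ℝ × ℝ` with Lebesgue measure. Here:

* `integrableOn_inv_norm_ball` — `‖q‖⁻¹ ∈ L¹(B(0,r))` in `ℝ × ℝ` (Mathlib's polar formula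
  `integrableOn_fun_norm_addHaar`, any norm: `r · r⁻¹ = 1`);
* `gaussTestable_of_le` — a measurable `f` with `|f(q)| ≤ A + B|q₂| + D/‖q‖` on `S_L` is GAUSSIAN-TESTABLE on
  the strip, `∀ c > 0, ∀ y₀, ∫_{S_L} |f(q)| e^{−c(y₀ − q₂)²} dq < ∞` — the kernel hypothesis of the
  differentiation lemmas of `…Tools` II (`contDiff_integral_ker_smul`);
* the three cylinder kernels in physical variables, `K₁(q) = k₁(2πq/L)`, `K₂(q) = k₂(2πq/L)`,
  `Φ_L(q) = Φ(2πq/L)` (`k₁ = sinh t/(cosh t − cos s)`, `k₂ = sin s/(cosh t − cos s)`, `Φ = log(cosh t − cos s)`),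
  obey such bounds on `S_L` (`abs_rowKerU_le`, `abs_rowKerV_le`, `abs_rowLogKer_le`, from `…Tools` I) and are
  therefore Gaussian-testable (`gaussTestable_rowKerU/V/LogKer`), and measurable.
Registered sub-goal proved here: `stub_rowVorticityConstruction_kernelsGaussTestable`. All `[folklore]`.
-/

set_option linter.dupNamespace false

noncomputable section

open Real Set Filter Topology MeasureTheory

namespace Summit.AnomalousDissipation.AnomalousDissipation.Theorems.MarginalStabilityChainStretchedVortexRows.RowBiotSavart

/-! ### `‖q‖⁻¹` is locally integrable in the plane -/

/-- `‖q‖⁻¹` is integrable on every ball of `ℝ × ℝ` (polar coordinates for the sup norm: the radial density is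
`r^{2−1} · r⁻¹ = 1`). [folklore] -/
theorem integrableOn_inv_norm_ball (r : ℝ) : IntegrableOn (fun q : ℝ × ℝ => ‖q‖⁻¹) (Metric.ball 0 r) := by
  have h := (integrableOn_fun_norm_addHaar (E := ℝ × ℝ) (volume : Measure (ℝ × ℝ)) (f := fun y : ℝ => y⁻¹)
    (r := r)).2
  apply h
  have hdim : Module.finrank ℝ (ℝ × ℝ) = 2 := by simp
  rw [hdim]
  refine ((integrableOn_const (C := (1:ℝ)) (measure_Ioo_lt_top).ne).congr_fun (fun y hy => ?_)
    measurableSet_Ioo)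
  have : y ≠ 0 := hy.1.ne'
  simp [this]

/-! ### The period strip -/

/-- Points of the centred period strip have `|q₁| ≤ L/2`. [folklore] -/
theorem abs_fst_le_of_mem_strip {L : ℝ} {q : ℝ × ℝ} (hq : q ∈ Ioc (-(L / 2)) (L / 2) ×ˢ (univ : Set ℝ)) :
    |q.1| ≤ L / 2 := by
  rw [mem_prod, mem_Ioc] at hq
  exact abs_le.2 ⟨hq.1.1.le, hq.1.2⟩

/-- On the centred period strip the normalised abscissa `2πq₁/L` lies in `[−π, π]`. [folklore] -/
theorem abs_normFst_le_pi {L : ℝ} (hL : 0 < L) {q : ℝ × ℝ}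
    (hq : q ∈ Ioc (-(L / 2)) (L / 2) ×ˢ (univ : Set ℝ)) : |2 * π * q.1 / L| ≤ π := by
  have h := abs_fst_le_of_mem_strip hq
  rw [abs_div, abs_mul, abs_of_pos hL, abs_of_pos (by positivity : (0:ℝ) < 2 * π), div_le_iff₀ hL]
  nlinarith [Real.pi_pos]

/-- The norm of the normalised point `2πq/L` is `(2π/L)‖q‖`. [folklore] -/
theorem norm_normPt {L : ℝ} (hL : 0 < L) (q : ℝ × ℝ) :
    ‖((2 * π * q.1 / L, 2 * π * q.2 / L) : ℝ × ℝ)‖ = 2 * π / L * ‖q‖ := by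
  have : ((2 * π * q.1 / L, 2 * π * q.2 / L) : ℝ × ℝ) = (2 * π / L) • q := by
    ext <;> simp <;> ring
  rw [this, norm_smul, Real.norm_eq_abs, abs_of_pos (by positivity)]

/-- The strip measure is the product of Lebesgue on the period with Lebesgue on the line. [folklore] -/
theorem volume_restrict_strip (L : ℝ) :
    (volume : Measure (ℝ × ℝ)).restrict (Ioc (-(L / 2)) (L / 2) ×ˢ (univ : Set ℝ)) =
      ((volume : Measure ℝ).restrict (Ioc (-(L / 2)) (L / 2))).prod (volume : Measure ℝ) := by
  rw [show (volume : Measure (ℝ × ℝ)) = (volume : Measure ℝ).prod (volume : Measure ℝ) from rfl,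
    ← Measure.prod_restrict, Measure.restrict_univ]

/-- A function of `q₂` alone that is integrable on the line is integrable on the strip. [folklore] -/
theorem integrable_strip_of_snd (L : ℝ) {g : ℝ → ℝ} (hg : Integrable g) :
    Integrable (fun q : ℝ × ℝ => g q.2)
      ((volume : Measure (ℝ × ℝ)).restrict (Ioc (-(L / 2)) (L / 2) ×ˢ (univ : Set ℝ))) := by
  rw [volume_restrict_strip]
  haveI : IsFiniteMeasure ((volume : Measure ℝ).restrict (Ioc (-(L / 2)) (L / 2))) :=
    ⟨by rw [Measure.restrict_apply_univ]; exact measure_Ioc_lt_top⟩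
  exact hg.comp_snd _

/-- The shifted Gaussian moment `(α + β|y₀ − t|) e^{−c(y₀ − t)²}` is integrable on the line (`c > 0`).
[folklore] -/
theorem integrable_affine_mul_gauss_shift {c : ℝ} (hc : 0 < c) (α β y₀ : ℝ) :
    Integrable fun t : ℝ => (α + β * |y₀ - t|) * Real.exp (-c * (y₀ - t) ^ 2) := by
  have h0 : Integrable fun s : ℝ => (α + β * |s|) * Real.exp (-c * s ^ 2) := by
    have h1 : Integrable fun s : ℝ => Real.exp (-c * s ^ 2) := integrable_exp_neg_mul_sq hc
    have h2 : Integrable fun s : ℝ => |s| * Real.exp (-c * s ^ 2) := by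
      have h := (integrable_mul_exp_neg_mul_sq hc).norm
      refine h.congr (Eventually.of_forall fun s => ?_)
      simp only [norm_mul, Real.norm_eq_abs, abs_of_pos (Real.exp_pos _)]
    have : (fun s : ℝ => (α + β * |s|) * Real.exp (-c * s ^ 2)) =
        fun s => α * Real.exp (-c * s ^ 2) + β * (|s| * Real.exp (-c * s ^ 2)) := by
      funext s; ring
    rw [this]
    exact (h1.const_mul α).add (h2.const_mul β)
  exact h0.comp_sub_left y₀

/-- **Gaussian-testability from a `1/r` bound.** A measurable `f` with `|f(q)| ≤ A + B|q₂| + D/‖q‖` on the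
strip (`B, D ≥ 0`) satisfies `∫_{S_L} |f(q)| e^{−c(y₀−q₂)²} dq < ∞` for all `c > 0`, `y₀`. [folklore] -/
theorem gaussTestable_of_le {L : ℝ} {f : ℝ × ℝ → ℝ} (hf : Measurable f) {A B D : ℝ}
    (hB : 0 ≤ B) (hD : 0 ≤ D)
    (hle : ∀ q ∈ Ioc (-(L / 2)) (L / 2) ×ˢ (univ : Set ℝ), |f q| ≤ A + B * |q.2| + D / ‖q‖) :
    ∀ c : ℝ, 0 < c → ∀ y₀ : ℝ, Integrable (fun q : ℝ × ℝ => ‖f q‖ * Real.exp (-c * (y₀ - q.2) ^ 2))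
      ((volume : Measure (ℝ × ℝ)).restrict (Ioc (-(L / 2)) (L / 2) ×ˢ (univ : Set ℝ))) := by
  intro c hc y₀
  set S : Set (ℝ × ℝ) := Ioc (-(L / 2)) (L / 2) ×ˢ (univ : Set ℝ)
  -- dominator: Gaussian moment in `q₂` plus the truncated `1/r`
  have h1 : Integrable (fun q : ℝ × ℝ => (A + D + B * |y₀| + B * |y₀ - q.2|) * Real.exp (-c * (y₀ - q.2) ^ 2))
      (volume.restrict S) :=
    integrable_strip_of_snd L (integrable_affine_mul_gauss_shift hc (A + D + B * |y₀|) B y₀)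
  have h2 : Integrable (fun q : ℝ × ℝ => (Metric.ball (0 : ℝ × ℝ) 1).indicator (fun q => ‖q‖⁻¹) q)
      (volume.restrict S) :=
    ((integrableOn_inv_norm_ball 1).integrable_indicator measurableSet_ball).mono_measure
      Measure.restrict_le_self
  refine Integrable.mono' (h1.add (h2.const_mul D))
    ((hf.norm.mul (by fun_prop)).aestronglyMeasurable) ?_
  rw [ae_restrict_iff' (measurableSet_Ioc.prod MeasurableSet.univ)]
  refine Eventually.of_forall fun q hq => ?_
  have hfq := hle q hq
  have he0 : 0 < Real.exp (-c * (y₀ - q.2) ^ 2) := Real.exp_pos _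
  have he1 : Real.exp (-c * (y₀ - q.2) ^ 2) ≤ 1 := by
    rw [Real.exp_le_one_iff]; nlinarith [sq_nonneg (y₀ - q.2)]
  rw [Real.norm_eq_abs, abs_mul, abs_norm, abs_of_pos he0, Real.norm_eq_abs]
  -- the truncated `1/r`
  have hD' : D / ‖q‖ ≤ D + D * (Metric.ball (0 : ℝ × ℝ) 1).indicator (fun q => ‖q‖⁻¹) q := by
    by_cases hq1 : q ∈ Metric.ball (0 : ℝ × ℝ) 1
    · rw [indicator_of_mem hq1, div_eq_mul_inv]; linarith
    · rw [indicator_of_notMem hq1, mul_zero, add_zero]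
      rw [Metric.mem_ball, dist_zero_right, not_lt] at hq1
      exact div_le_self hD hq1
  have hy : |q.2| ≤ |y₀| + |y₀ - q.2| := by
    have := abs_sub_abs_le_abs_sub q.2 y₀
    rw [abs_sub_comm] at this; linarith
  have hind : 0 ≤ (Metric.ball (0 : ℝ × ℝ) 1).indicator (fun q : ℝ × ℝ => ‖q‖⁻¹) q :=
    indicator_nonneg (fun q _ => inv_nonneg.2 (norm_nonneg q)) q
  calc |f q| * Real.exp (-c * (y₀ - q.2) ^ 2)
      ≤ (A + B * |q.2| + D / ‖q‖) * Real.exp (-c * (y₀ - q.2) ^ 2) :=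
        mul_le_mul_of_nonneg_right hfq he0.le
    _ ≤ (A + B * (|y₀| + |y₀ - q.2|) + (D + D * (Metric.ball (0 : ℝ × ℝ) 1).indicator (fun q => ‖q‖⁻¹) q)) *
          Real.exp (-c * (y₀ - q.2) ^ 2) := by
        apply mul_le_mul_of_nonneg_right _ he0.le
        nlinarith [mul_le_mul_of_nonneg_left hy hB]
    _ = (A + D + B * |y₀| + B * |y₀ - q.2|) * Real.exp (-c * (y₀ - q.2) ^ 2) +
          D * (Metric.ball (0 : ℝ × ℝ) 1).indicator (fun q => ‖q‖⁻¹) q * Real.exp (-c * (y₀ - q.2) ^ 2) := by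
        ring
    _ ≤ (A + D + B * |y₀| + B * |y₀ - q.2|) * Real.exp (-c * (y₀ - q.2) ^ 2) +
          D * (Metric.ball (0 : ℝ × ℝ) 1).indicator (fun q => ‖q‖⁻¹) q := by
        have : D * (Metric.ball (0 : ℝ × ℝ) 1).indicator (fun q : ℝ × ℝ => ‖q‖⁻¹) q *
            Real.exp (-c * (y₀ - q.2) ^ 2) ≤ D * (Metric.ball (0 : ℝ × ℝ) 1).indicator (fun q => ‖q‖⁻¹) q * 1 :=
          mul_le_mul_of_nonneg_left he1 (mul_nonneg hD hind)
        linarith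

/-! ### The three cylinder kernels on the strip -/

/-- `|K₁(q)| ≤ 2 + (10L/π)/‖q‖` on the strip, `K₁(q) = sinh(2πq₂/L)/(cosh(2πq₂/L) − cos(2πq₁/L))`. [folklore] -/
theorem abs_rowKerU_le {L : ℝ} (hL : 0 < L) {q : ℝ × ℝ} (hq : q ∈ Ioc (-(L / 2)) (L / 2) ×ˢ (univ : Set ℝ)) :
    |Real.sinh (2 * π * q.2 / L) / (Real.cosh (2 * π * q.2 / L) - Real.cos (2 * π * q.1 / L))| ≤
      2 + 10 * L / π / ‖q‖ := by
  have h := abs_kerU_le (z := ((2 * π * q.1 / L, 2 * π * q.2 / L) : ℝ × ℝ)) (abs_normFst_le_pi hL hq)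
  rw [norm_normPt hL] at h
  convert h using 2
  field_simp
  ring

/-- `|K₂(q)| ≤ 2 + (10L/π)/‖q‖` on the strip, `K₂(q) = sin(2πq₁/L)/(cosh(2πq₂/L) − cos(2πq₁/L))`. [folklore] -/
theorem abs_rowKerV_le {L : ℝ} (hL : 0 < L) {q : ℝ × ℝ} (hq : q ∈ Ioc (-(L / 2)) (L / 2) ×ˢ (univ : Set ℝ)) :
    |Real.sin (2 * π * q.1 / L) / (Real.cosh (2 * π * q.2 / L) - Real.cos (2 * π * q.1 / L))| ≤
      2 + 10 * L / π / ‖q‖ := by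
  have h := abs_kerV_le (z := ((2 * π * q.1 / L, 2 * π * q.2 / L) : ℝ × ℝ)) (abs_normFst_le_pi hL hq)
  rw [norm_normPt hL] at h
  convert h using 2
  field_simp
  ring

/-- `|Φ_L(q)| ≤ 10 + (6π/L)|q₂| + (L/π)/‖q‖` on the strip, `Φ_L(q) = log(cosh(2πq₂/L) − cos(2πq₁/L))`.
[folklore] -/
theorem abs_rowLogKer_le {L : ℝ} (hL : 0 < L) {q : ℝ × ℝ} (hq : q ∈ Ioc (-(L / 2)) (L / 2) ×ˢ (univ : Set ℝ)) :
    |Real.log (Real.cosh (2 * π * q.2 / L) - Real.cos (2 * π * q.1 / L))| ≤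
      10 + 6 * π / L * |q.2| + L / π / ‖q‖ := by
  have h := abs_logKer_le (z := ((2 * π * q.1 / L, 2 * π * q.2 / L) : ℝ × ℝ)) (abs_normFst_le_pi hL hq)
  rw [norm_normPt hL] at h
  have h2 : |2 * π * q.2 / L| = 2 * π / L * |q.2| := by
    rw [abs_div, abs_mul, abs_of_pos hL, abs_of_pos (by positivity : (0:ℝ) < 2 * π)]; ring
  simp only [h2] at h
  convert h using 2
  · ring
  · field_simp

/-- `K₁` is measurable. [folklore] -/
theorem measurable_rowKerU (L : ℝ) : Measurable fun q : ℝ × ℝ =>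
    Real.sinh (2 * π * q.2 / L) / (Real.cosh (2 * π * q.2 / L) - Real.cos (2 * π * q.1 / L)) := by
  fun_prop

/-- `K₂` is measurable. [folklore] -/
theorem measurable_rowKerV (L : ℝ) : Measurable fun q : ℝ × ℝ =>
    Real.sin (2 * π * q.1 / L) / (Real.cosh (2 * π * q.2 / L) - Real.cos (2 * π * q.1 / L)) := by
  fun_prop

/-- `Φ_L` is measurable. [folklore] -/
theorem measurable_rowLogKer (L : ℝ) : Measurable fun q : ℝ × ℝ =>
    Real.log (Real.cosh (2 * π * q.2 / L) - Real.cos (2 * π * q.1 / L)) := by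
  fun_prop

/-- **`K₁` is Gaussian-testable on the strip.** [folklore] -/
theorem gaussTestable_rowKerU {L : ℝ} (hL : 0 < L) :
    ∀ c : ℝ, 0 < c → ∀ y₀ : ℝ, Integrable (fun q : ℝ × ℝ =>
      ‖Real.sinh (2 * π * q.2 / L) / (Real.cosh (2 * π * q.2 / L) - Real.cos (2 * π * q.1 / L))‖ *
        Real.exp (-c * (y₀ - q.2) ^ 2))
      ((volume : Measure (ℝ × ℝ)).restrict (Ioc (-(L / 2)) (L / 2) ×ˢ (univ : Set ℝ))) :=
  gaussTestable_of_le (measurable_rowKerU L) (A := 2) (B := 0) (D := 10 * L / π) le_rfl (by positivity)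
    fun q hq => by simpa using abs_rowKerU_le hL hq

/-- **`K₂` is Gaussian-testable on the strip.** [folklore] -/
theorem gaussTestable_rowKerV {L : ℝ} (hL : 0 < L) :
    ∀ c : ℝ, 0 < c → ∀ y₀ : ℝ, Integrable (fun q : ℝ × ℝ =>
      ‖Real.sin (2 * π * q.1 / L) / (Real.cosh (2 * π * q.2 / L) - Real.cos (2 * π * q.1 / L))‖ *
        Real.exp (-c * (y₀ - q.2) ^ 2))
      ((volume : Measure (ℝ × ℝ)).restrict (Ioc (-(L / 2)) (L / 2) ×ˢ (univ : Set ℝ))) :=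
  gaussTestable_of_le (measurable_rowKerV L) (A := 2) (B := 0) (D := 10 * L / π) le_rfl (by positivity)
    fun q hq => by simpa using abs_rowKerV_le hL hq

/-- **`Φ_L` is Gaussian-testable on the strip.** [folklore] -/
theorem gaussTestable_rowLogKer {L : ℝ} (hL : 0 < L) :
    ∀ c : ℝ, 0 < c → ∀ y₀ : ℝ, Integrable (fun q : ℝ × ℝ =>
      ‖Real.log (Real.cosh (2 * π * q.2 / L) - Real.cos (2 * π * q.1 / L))‖ *
        Real.exp (-c * (y₀ - q.2) ^ 2))
      ((volume : Measure (ℝ × ℝ)).restrict (Ioc (-(L / 2)) (L / 2) ×ˢ (univ : Set ℝ))) :=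
  gaussTestable_of_le (measurable_rowLogKer L) (A := 10) (B := 6 * π / L) (D := L / π) (by positivity)
    (by positivity) fun q hq => abs_rowLogKer_le hL hq

end RowBiotSavart

/-- **The three cylinder kernels are Gaussian-testable on the period strip** (registered on
stmt-AnomalousDissipation-3009 as the helper stub `stub_rowVorticityConstruction_kernelsGaussTestable` of
`stub_rowVorticityConstruction`): for `L > 0`, `c > 0`, `y₀ ∈ ℝ`, the functions `|K₁(q)| e^{−c(y₀−q₂)²}`,
`|K₂(q)| e^{−c(y₀−q₂)²}`, `|Φ_L(q)| e^{−c(y₀−q₂)²}` are integrable on `S_L = (−L/2, L/2] × ℝ` — the kernel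
hypothesis of `stub_rowVorticityConstruction_diffUnderIntegral` (`RowBiotSavart.gaussTestable_rowKerU/V/LogKer`).
[folklore] -/
theorem stub_rowVorticityConstruction_kernelsGaussTestable :
    ∀ L : ℝ, 0 < L → ∀ c : ℝ, 0 < c → ∀ y₀ : ℝ,
      MeasureTheory.Integrable (fun q : ℝ × ℝ =>
        ‖Real.sinh (2 * Real.pi * q.2 / L) / (Real.cosh (2 * Real.pi * q.2 / L) - Real.cos (2 * Real.pi * q.1 / L))‖ *
          Real.exp (-c * (y₀ - q.2) ^ 2))
        ((MeasureTheory.volume : MeasureTheory.Measure (ℝ × ℝ)).restrict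
          (Set.Ioc (-(L / 2)) (L / 2) ×ˢ (Set.univ : Set ℝ))) ∧
      MeasureTheory.Integrable (fun q : ℝ × ℝ =>
        ‖Real.sin (2 * Real.pi * q.1 / L) / (Real.cosh (2 * Real.pi * q.2 / L) - Real.cos (2 * Real.pi * q.1 / L))‖ *
          Real.exp (-c * (y₀ - q.2) ^ 2))
        ((MeasureTheory.volume : MeasureTheory.Measure (ℝ × ℝ)).restrict
          (Set.Ioc (-(L / 2)) (L / 2) ×ˢ (Set.univ : Set ℝ))) ∧
      MeasureTheory.Integrable (fun q : ℝ × ℝ =>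
        ‖Real.log (Real.cosh (2 * Real.pi * q.2 / L) - Real.cos (2 * Real.pi * q.1 / L))‖ *
          Real.exp (-c * (y₀ - q.2) ^ 2))
        ((MeasureTheory.volume : MeasureTheory.Measure (ℝ × ℝ)).restrict
          (Set.Ioc (-(L / 2)) (L / 2) ×ˢ (Set.univ : Set ℝ))) :=
  fun _ hL c hc y₀ => ⟨RowBiotSavart.gaussTestable_rowKerU hL c hc y₀, RowBiotSavart.gaussTestable_rowKerV hL c hc y₀,
    RowBiotSavart.gaussTestable_rowLogKer hL c hc y₀⟩

end Summit.AnomalousDissipation.AnomalousDissipation.Theorems.MarginalStabilityChainStretchedVortexRows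

end
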